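import Summits.MatrixMultiplication.OmegaCensus.DominoZ19StructSixDataE3
import HarnessLib

/-!
# Excluded list (literal chunks) and codes for the structural part-`6` route, `p = 19` (file 4 of 4)

ω-census `pub-omega`, family (b3), seat pub-omega-group gen 25.  Framing: lottery ticket; floor = certified bounds/negative
ranges.  VALUE: per-prime kernel data of the structural part-`6` route WITHOUT the pigeonhole (`DominoZpZpStructSixWide*.lean`)
for `p = 19` — target: the OPEN census cell `(1,6,20)@361` (`A = ℤ₁₉²`) and every larger order with such a quotient; NOT progress on ω.

-/

namespace Summit.MatrixMultiplication.OmegaCensus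

open ZpZpDomino

namespace ZpZpDomino

/-- The same codes, sorted (for the balanced key tree) — chunk 5 of 5. [folklore] -/
def ecsZ19s6_5 : List ℕ := [
  1633258048666440, 1633354943206014, 1633356914767956, 1633839382495644, 1633839388291656, 1634517888041340,
  1637908720930680, 1637908722579822, 1637908732577586, 1637909003407992, 1637910698257422, 1637910704022222,
  1637922562217880, 1637922562219944, 1637922563043480, 1637922602571192, 1637922602688792, 1637936443858344,
  1638602762617128, 1661646528497214, 1661646528602550, 1661646568838508, 1661646568851150, 1661646609304914,
  1661647093548198, 1661647099195398, 1661647104960150, 1661648546165202, 1661648586514056, 1661648587337550,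
  1661648788315656, 1661650483138338, 1661650483253586, 1661650523489544, 1661660934720150, 1661660940482550,
  1661743417507362, 1661743418314098, 1661743699999320, 1661840312265714, 1661840588976162, 1662352439892102,
  1663017098388198, 1666394090011602, 1666394091653886, 1666394130578898, 1671141651502680, 1671252381797544,
  1694879465049750, 1694879465654802, 1694879465755644, 1694879741558514, 1694881436378844, 1695557682124950,
  1695557688004950, 1695557723299650, 1695571523409708, 1695571805884950, 1696249746482550, 1699627026326796,
  1699723909570002, 1700402132642850, 1861044111897714, 1861044111900120, 1861044111919608, 1861044112721934,
  1861044119427192, 1861044164604408, 1861044394394514, 1861044676965852, 1861044676966146, 1861046089260414,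
  1861046090871492, 1861046100754008, 1861048066570350, 1861048066584756, 1861048067374734, 1861048349028792,
  1861057964714802, 1861057993543266, 1861059930545214, 1861062190313592, 1861071795298002, 1861141012438008,
  1861141283618610, 1861237895683614, 1861722334987410, 1861722335088252, 1861722346516914, 1861722617681052,
  1862414439684162, 1862497729529010, 1862594336064168, 1865791675172334, 1865791685054850, 1867150096880040,
  1867245008563704, 1894277054820402, 1903869054497550, 1932935757619650, 2093674638238008, 2093674667179662,
  2093676885703662, 2093771514895662, 2093773493045556, 2093785356182814, 2093799197469672, 2094352848957810,
  2126907556457208, 2126907557395656, 2126907563042808, 2126909816256456, 2127018286752072, 2131655117964408,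
  2132333341037256, 2164888048534008, 3256827195943356, 3256827196646940, 3256827202409244, 3256827282292914,
  3256827761594988, 3256829738098482, 3256831150594434, 3256843014468456, 3256844991761586, 3256854878529756,
  3256854884160150, 3256924125189714, 3256924165538862, 3256926062393346, 3257020979608914, 3257505419717976,
  3257505420658482, 3257505430425750, 3258183641983410, 3258183924442188, 3261574757347746, 3261574797718062,
  3261575041453176, 3266336160128034, 3266419490326440, 3290060126390856, 3290073967678386, 3290255881738056,
  3323293056960150, 3323971280032956, 3489457709808114, 3489457710060210, 3489457761691314, 3494205271318062,
  3722088546624168, 3755321154364914]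

/-- The same codes, sorted (for the balanced key tree). [folklore] -/
def ecsZ19s6 : List ℕ := ecsZ19s6_1 ++ ecsZ19s6_2 ++ ecsZ19s6_3 ++ ecsZ19s6_4 ++ ecsZ19s6_5

end ZpZpDomino

end Summit.MatrixMultiplication.OmegaCensus
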